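import Summits.CriticalPhenomena.PercolationContinuityZ3.Theorems.SahiMasterFamilyAllR3Prelim
import Summits.CriticalPhenomena.PercolationContinuityZ3.Theorems.SahiMasterFamilyFourStep

/-!
# (ALL-R3): quadruples in which every coordinate is essential for exactly three members are detected by THEOREM R

Unit `prim-masterthm-p4` (gen 9), crux anchor stmt-CriticalPhenomena-4575.  Seat document HOME/prim-masterthm-p4/PROOF-CAP-NOTES.md §7 (Theorem 2).

THEOREM (gen 8's conjecture (ALL-R3), now proved, every size of the ground set).  Let `U_0,…,U_3` be non-constant increasing events on `{0,1}^ι`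
such that EVERY coordinate is essential for exactly three of them ("all-r3": for each `e` exactly one member `U_{τ(e)}` ignores `e`), and no sub-triple lies in
`Z_3`.  Then `E_4(μ_p; 1_U) ≠ 0` for some interior `p` (`exists_interior_sahiE_four_ne_zero_of_allR3`).

PROOF.  Suppose `E_4 ≡ 0`.  By THEOREM R* (gen 8, `RigidityAll.trivial_form_at`) every coordinate `e`, with free member `f = τ(e)`, is in TRIVIAL FORM:
exactly one other member `l = j₀(e)` ("active at `e`") has its pivotal set `Piv_e U_l` meeting `U_f`, and that pivotal set ignores every coordinate that
`U_f` uses — i.e. it is determined by the type class `T^f := {y | U_f ignores y}` (minus `e`).  Two consequences for an active pair `(l, f)`: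
(KEY) every configuration of `U_l` meets `T^f` (`inter_type_nonempty_of_active`), and (M) `U_l` has a configuration inside `T^f` (`exists_subset_type_of_active`);
so a member is active for at most one type.  If a type had a unique active member `l`, then `U_l` would ignore everything outside that type
(`not_affects_of_unique_active`) — impossible, since with ≥ 3 non-empty types `U_l` uses another type; so every non-empty type has two active members, and
counting active pairs gives `6 ≤ 4`.  With exactly two non-empty types the two "small" members are independent and the family has a `Z_3` sub-triple
(slot = a full-support member), excluded.  No positivity is involved; axioms standard. [this work]
-/

noncomputable section

open scoped Classical

namespace Summit.CriticalPhenomena.PercolationContinuityZ3.Theorems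

namespace AllR3

open Finset Function
open Literature.Combinatorics.Sahi2008
open Literature.Probability.LatticeModels.Kahn2022 (Affects)
open Literature.Probability.Percolation (DeterminedBy determinedBy_iff)
open Literature.Probability.Percolation.DecisionTree (ind ind_of_mem ind_of_not_mem)
open SharedCoordinate RigidityAll

variable {ι : Type} [Fintype ι]

/-! ### The all-r3 setting -/

section Family

variable (U : Fin 4 → Set (Set ι)) (hU : ∀ j, IsUpperSet (U j)) (hne : ∀ j, (U j).Nonempty)
  (τ : ι → Fin 4) (hτ : ∀ e ω, insert e ω ∈ U (τ e) ↔ ω ∈ U (τ e)) (haff : ∀ e j, j ≠ τ e → Affects (U j) e)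

omit [Fintype ι] in
include haff in
/-- The type of a coordinate is the unique member ignoring it. [this work] -/
theorem type_eq_of_ignores {e : ι} {f : Fin 4} (h : ∀ ω, insert e ω ∈ U f ↔ ω ∈ U f) : τ e = f := by
  by_contra hne'
  exact not_affects_of_forall_insert_iff h (haff e f (Ne.symm hne'))

include hU hne hτ haff in
/-- **Trivial form at `e`** (from THEOREM R*, given `E_4 ≡ 0`): an active member `a ≠ τ e` whose pivotal set meets `U (τ e)` and ignores every coordinate
that `U (τ e)` uses, the other two pivotal sets missing `U (τ e)`. [this work] -/
theorem exists_active (hzero : ∀ p : ι → unitInterval, (∀ i, (p i : ℝ) ∈ Set.Ioo (0 : ℝ) 1) → sahiE (bernoulliWeight p) 4 (fun j => ind (U j)) = 0)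
    (e : ι) : ∃ a : Fin 4, a ≠ τ e ∧ (pivSet e (U a) ∩ U (τ e)).Nonempty ∧
      (∀ l, l ≠ τ e → l ≠ a → pivSet e (U l) ∩ U (τ e) = ∅) ∧
      (∀ y, y ≠ e → τ y ≠ τ e → ∀ ω, insert y ω ∈ pivSet e (U a) ↔ ω ∈ pivSet e (U a)) := by
  have hpiv : ∀ j : Fin 3, (pivSet e (U ((τ e).succAbove j))).Nonempty :=
    fun j => pivSet_nonempty_of_affects (hU _) (haff e _ (Fin.succAbove_ne _ _))
  obtain ⟨j₀, hmeet, hmiss, hsupp⟩ := trivial_form_at (n := 2) U e (τ e) hU (hτ e) (hne _) hpiv hzero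
  refine ⟨(τ e).succAbove j₀, Fin.succAbove_ne _ _, hmeet, fun l hl hla => ?_, fun y hye hy ω => ?_⟩
  · obtain ⟨l', rfl⟩ := Fin.exists_succAbove_eq hl
    exact hmiss l' fun h => hla (by rw [h])
  · rcases hsupp y with h | h
    · exact absurd (type_eq_of_ignores U τ haff (forall_iff_of_ignores h)) hy
    · exact forall_iff_of_ignores h ω

end Family


section Family2

variable (U : Fin 4 → Set (Set ι)) (hU : ∀ j, IsUpperSet (U j)) (hne : ∀ j, (U j).Nonempty)
  (τ : ι → Fin 4) (hτ : ∀ e ω, insert e ω ∈ U (τ e) ↔ ω ∈ U (τ e)) (haff : ∀ e j, j ≠ τ e → Affects (U j) e)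

omit [Fintype ι] in
include hτ in
/-- A coordinate affecting `U j` has type `≠ j`. [this work] -/
theorem type_ne_of_affects {z : ι} {j : Fin 4} (h : Affects (U j) z) : τ z ≠ j := by
  rintro rfl; exact not_affects_of_forall_insert_iff (hτ z) h

include hU hne hτ haff in
/-- **Two types only: the cross intersections ignore the small types.**  If every coordinate has type `f` or `g` (`f ≠ g`), `a ∉ {f, g}`, and at every
coordinate of type `f` the active member is unique with the properties of `exists_active`, then `U f ∩ U a` ignores every coordinate of type `f`. [this work] -/
theorem not_affects_inter_of_two_types {f g a : Fin 4} (hfg : f ≠ g) (haf : a ≠ f) (hag : a ≠ g) (htwo : ∀ e, τ e = f ∨ τ e = g)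
    (act : ι → Fin 4) (hmiss : ∀ e l, l ≠ τ e → l ≠ act e → pivSet e (U l) ∩ U (τ e) = ∅)
    {z : ι} (hz : τ z = f) : ¬ Affects (U f ∩ U a) z := by
  -- first, the active member at `z` is `g`
  have hactz : act z = g := by
    by_contra hne'
    have hempty := hmiss z g (by rw [hz]; exact hfg.symm) (Ne.symm hne')
    -- build a configuration in `Piv_z (U g) ∩ U f`
    obtain ⟨ω₀, hω₀⟩ := pivSet_nonempty_of_affects (hU g) (haff z g (by rw [hz]; exact hfg.symm))
    set ω₁ : Set ι := {y | y ∈ ω₀ ∨ τ y = g} with hω₁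
    have h1 : ω₁ ∈ pivSet z (U g) := by
      refine (mem_iff_of_forall_insert_iff (pivSet z (U g)) {y | τ y = f} (fun y hy ω => ?_) (ω := ω₀) (ω' := ω₁)
        (fun y hy => ?_)).1 hω₀
      · have hyg : τ y = g := (htwo y).resolve_left hy
        have hyz : y ≠ z := by rintro rfl; exact hy hz
        exact insert_mem_pivSet_iff hyz (fun ω' => by rw [← hyg]; exact hτ y ω') ω
      · have : τ y ≠ g := by rw [show τ y = f from hy]; exact hfg
        simp [hω₁, this]
    have h2 : ω₁ ∈ U (τ z) := by
      rw [hz]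
      have huniv : Set.univ ∈ U f := univ_mem_of_nonempty (hU f) (hne f)
      refine (mem_iff_of_forall_insert_iff (U f) {y | τ y = g} (fun y hy ω => ?_) (ω := Set.univ) (ω' := ω₁)
        (fun y hy => ?_)).1 huniv
      · have hyf : τ y = f := (htwo y).resolve_right hy
        rw [← hyf]; exact hτ y ω
      · simp [hω₁, show τ y = g from hy]
    have : ω₁ ∈ pivSet z (U g) ∩ U (τ z) := ⟨h1, h2⟩
    rw [hempty] at this
    exact this
  -- now the voter `a` misses `U f` at `z`
  have hempty := hmiss z a (by rw [hz]; exact haf) (by rw [hactz]; exact hag)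
  rintro ⟨ω, hω, hins⟩
  have hωf : ω ∈ U f := by have := (hτ z ω).1; rw [hz] at this; exact this hins.1
  have hωa : ω ∉ U a := fun h => hω ⟨hωf, h⟩
  have hpiv : ω \ {z} ∈ pivSet z (U a) :=
    mem_pivSet_of_pivotal (fun h => h.2 rfl) (fun h => hωa (hU a Set.sdiff_subset h)) (by rw [Set.insert_sdiff_singleton]; exact hins.2)
  have hf' : ω \ {z} ∈ U (τ z) := by
    have := (hτ z (ω \ {z})).1
    rw [Set.insert_sdiff_singleton] at this
    have hins1 : insert z ω ∈ U (τ z) := by rw [hz]; exact hins.1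
    exact this hins1
  have : ω \ {z} ∈ pivSet z (U a) ∩ U (τ z) := ⟨hpiv, hf'⟩
  rw [hempty] at this
  exact this

end Family2

/-! ### The theorem -/

/-- **(ALL-R3).**  Four non-empty increasing events, every coordinate ignored by exactly one of them and essential for the other three, no sub-triple in `Z_3`:
then `E_4(μ_p; 1_U) ≠ 0` for some interior `p`. [this work] -/
theorem exists_interior_sahiE_four_ne_zero_of_allR3 (U : Fin 4 → Set (Set ι)) (hU : ∀ j, IsUpperSet (U j)) (hne : ∀ j, (U j).Nonempty)
    (hr3 : ∀ e : ι, ∃ f : Fin 4, (∀ ω, insert e ω ∈ U f ↔ ω ∈ U f) ∧ ∀ j, j ≠ f → Affects (U j) e)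
    (hno : ∀ m : Fin 4, ¬ SuppZeroFlag 3 (fun j => U (m.succAbove j))) :
    ∃ p : ι → unitInterval, (∀ i, (p i : ℝ) ∈ Set.Ioo (0 : ℝ) 1) ∧ sahiE (bernoulliWeight p) 4 (fun j => ind (U j)) ≠ 0 := by
  by_contra hall
  push Not at hall
  choose τ hτ haff using hr3
  choose act hact_ne hmeet hmiss hdet using exists_active U hU hne τ hτ haff hall
  -- determinedness of the active pivotal set by the type class
  have hdet' : ∀ e y, y ∉ ({y | τ y = τ e} : Set ι) → ∀ ω, insert y ω ∈ pivSet e (U (act e)) ↔ ω ∈ pivSet e (U (act e)) := by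
    intro e y hy ω
    have hy' : τ y ≠ τ e := hy
    exact hdet e y (by rintro rfl; exact hy' rfl) hy' ω
  have hpne : ∀ e, (pivSet e (U (act e))).Nonempty := fun e => (hmeet e).mono Set.inter_subset_left
  -- (KEY) and (M)
  have KEY : ∀ e, ∀ θ ∈ U (act e), ∃ z ∈ ({y | τ y = τ e} : Set ι), z ∈ θ :=
    fun e θ hθ => inter_type_nonempty_of_active (hU _) (show e ∈ ({y | τ y = τ e} : Set ι) from rfl) (hdet' e) (hpne e) hθ
  have M : ∀ e, ∃ θ ∈ U (act e), θ ⊆ ({y | τ y = τ e} : Set ι) :=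
    fun e => exists_subset_type_of_active (show e ∈ ({y | τ y = τ e} : Set ι) from rfl) (hdet' e) (hpne e)
  -- a member is active for one type only
  have one_type : ∀ e e', act e = act e' → τ e = τ e' := by
    intro e e' h
    obtain ⟨θ, hθ, hsub⟩ := M e'
    rw [← h] at hθ
    obtain ⟨z, hz, hzθ⟩ := KEY e θ hθ
    have : τ z = τ e' := hsub hzθ
    exact hz.symm.trans this
  by_cases h3 : ∃ e₁ e₂ e₃ : ι, τ e₁ ≠ τ e₂ ∧ τ e₁ ≠ τ e₃ ∧ τ e₂ ≠ τ e₃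
  · -- CASE A: three types.  Every type has two active members (UNI), and active sets of different types are disjoint: 6 ≤ 4.
    obtain ⟨e₁, e₂, e₃, h12, h13, h23⟩ := h3
    have two : ∀ e, ∃ e', τ e' = τ e ∧ act e' ≠ act e := by
      intro e
      by_contra hcon
      push Not at hcon
      -- unique active member `act e` for the type of `e`: it ignores everything outside the type
      have hdetAll : ∀ e' ∈ ({y | τ y = τ e} : Set ι), ∀ y, y ∉ ({y | τ y = τ e} : Set ι) → ∀ ω,
          insert y ω ∈ pivSet e' (U (act e)) ↔ ω ∈ pivSet e' (U (act e)) := by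
        intro e' he' y hy ω
        have hae : act e' = act e := hcon e' he'
        have := hdet' e' y (by rw [show ({y | τ y = τ e'} : Set ι) = {y | τ y = τ e} from by rw [show τ e' = τ e from he']]; exact hy) ω
        rwa [hae] at this
      have huni := fun y (hy : y ∉ ({y | τ y = τ e} : Set ι)) => not_affects_of_unique_active (hU (act e)) hdetAll (KEY e) hy
      -- a coordinate whose type is neither `τ e` nor `act e`
      obtain ⟨y, hy1, hy2⟩ : ∃ y, τ y ≠ τ e ∧ τ y ≠ act e := by
        by_cases ha : τ e₁ ≠ τ e ∧ τ e₁ ≠ act e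
        · exact ⟨e₁, ha⟩
        by_cases hb : τ e₂ ≠ τ e ∧ τ e₂ ≠ act e
        · exact ⟨e₂, hb⟩
        refine ⟨e₃, fun h => ?_, fun h => ?_⟩ <;> simp only [not_and_or, not_not] at ha hb <;>
          rcases ha with ha | ha <;> rcases hb with hb | hb
        all_goals first
          | exact h12 (ha.trans hb.symm)
          | exact h13 (ha.trans h.symm)
          | exact h23 (hb.trans h.symm)
      exact huni y hy1 (haff y (act e) (Ne.symm hy2))
    -- counting: the active sets of the three types are pairwise disjoint and have two elements each
    have hdis : ∀ {u v : ι}, τ u ≠ τ v → act u ≠ act v := fun h heq => h (one_type _ _ heq)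
    obtain ⟨e₁', h1τ, h1a⟩ := two e₁
    obtain ⟨e₂', h2τ, h2a⟩ := two e₂
    obtain ⟨e₃', h3τ, h3a⟩ := two e₃
    let S₁ : Finset (Fin 4) := {act e₁, act e₁'}
    let S₂ : Finset (Fin 4) := {act e₂, act e₂'}
    let S₃ : Finset (Fin 4) := {act e₃, act e₃'}
    have c1 : S₁.card = 2 := card_pair (Ne.symm h1a)
    have c2 : S₂.card = 2 := card_pair (Ne.symm h2a)
    have c3 : S₃.card = 2 := card_pair (Ne.symm h3a)
    have d12 : Disjoint S₁ S₂ := by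
      rw [Finset.disjoint_left]; intro x hx1 hx2
      simp only [S₁, S₂, Finset.mem_insert, Finset.mem_singleton] at hx1 hx2
      rcases hx1 with rfl | rfl <;> rcases hx2 with h | h
      · exact hdis h12 h
      · exact hdis (by rw [h2τ]; exact h12) h
      · exact hdis (by rw [h1τ]; exact h12) h
      · exact hdis (by rw [h1τ, h2τ]; exact h12) h
    have d13 : Disjoint S₁ S₃ := by
      rw [Finset.disjoint_left]; intro x hx1 hx2
      simp only [S₁, S₃, Finset.mem_insert, Finset.mem_singleton] at hx1 hx2
      rcases hx1 with rfl | rfl <;> rcases hx2 with h | h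
      · exact hdis h13 h
      · exact hdis (by rw [h3τ]; exact h13) h
      · exact hdis (by rw [h1τ]; exact h13) h
      · exact hdis (by rw [h1τ, h3τ]; exact h13) h
    have d23 : Disjoint S₂ S₃ := by
      rw [Finset.disjoint_left]; intro x hx1 hx2
      simp only [S₂, S₃, Finset.mem_insert, Finset.mem_singleton] at hx1 hx2
      rcases hx1 with rfl | rfl <;> rcases hx2 with h | h
      · exact hdis h23 h
      · exact hdis (by rw [h3τ]; exact h23) h
      · exact hdis (by rw [h2τ]; exact h23) h
      · exact hdis (by rw [h2τ, h3τ]; exact h23) h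
    have hcard : (S₁ ∪ S₂ ∪ S₃).card = 6 := by
      rw [card_union_of_disjoint (disjoint_union_left.2 ⟨d13, d23⟩), card_union_of_disjoint d12, c1, c2, c3]
    have hle : (S₁ ∪ S₂ ∪ S₃).card ≤ 4 := (card_le_univ _).trans (by simp)
    omega
  · -- CASE B: at most two types `f ≠ g`
    push Not at h3
    obtain ⟨f, g, hfg, htwo⟩ : ∃ f g : Fin 4, f ≠ g ∧ ∀ e, τ e = f ∨ τ e = g := by
      by_cases hex : ∃ u v : ι, τ u ≠ τ v
      · obtain ⟨u, v, huv⟩ := hex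
        refine ⟨τ u, τ v, huv, fun e => ?_⟩
        by_contra hcon
        push Not at hcon
        exact hcon.2 (h3 u v e huv (Ne.symm hcon.1)).symm
      · push Not at hex
        by_cases hι : Nonempty ι
        · obtain ⟨e₀⟩ := hι
          have h01 : ∀ f : Fin 4, f ≠ f + 1 := by decide
          exact ⟨τ e₀, τ e₀ + 1, h01 _, fun e => Or.inl (hex e e₀)⟩
        · exact ⟨0, 1, by decide, fun e => (hι ⟨e⟩).elim⟩
    have aux : ∀ f g : Fin 4, f ≠ g → ∃ a m : Fin 4, a ≠ f ∧ a ≠ g ∧ m ≠ f ∧ m ≠ g ∧ m ≠ a := by decide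
    obtain ⟨a, m, haf, hag, hmf, hmg, hma⟩ := aux f g hfg
    have hcf : ∀ z, τ z = f → ¬ Affects (U f ∩ U a) z :=
      fun z hz => not_affects_inter_of_two_types U hU hne τ hτ haff hfg haf hag htwo act hmiss hz
    have hcg : ∀ z, τ z = g → ¬ Affects (U g ∩ U a) z :=
      fun z hz => not_affects_inter_of_two_types U hU hne τ hτ haff (Ne.symm hfg) hag haf (fun e => (htwo e).symm) act hmiss hz
    have htf : ∀ z, Affects (U f) z → τ z = g := fun z h => (htwo z).resolve_left (type_ne_of_affects U τ hτ h)
    have htg : ∀ z, Affects (U g) z → τ z = f := fun z h => (htwo z).resolve_right (type_ne_of_affects U τ hτ h)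
    have z1 : SuppZeroFlag 2 ![U f, U g] := by
      refine (suppZeroFlag_two_iff (hU f) (hU g)).2 (Finset.disjoint_left.2 fun z hz1 hz2 => ?_)
      have h1 := htf z (mem_esupp.1 hz1)
      have h2 := htg z (mem_esupp.1 hz2)
      exact hfg (h2.symm.trans h1)
    have z2 : SuppZeroFlag 2 ![U f ∩ U a, U g] := by
      refine (suppZeroFlag_two_iff ((hU f).inter (hU a)) (hU g)).2 (Finset.disjoint_left.2 fun z hz1 hz2 => ?_)
      exact hcf z (htg z (mem_esupp.1 hz2)) (mem_esupp.1 hz1)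
    have z3 : SuppZeroFlag 2 ![U f, U g ∩ U a] := by
      refine (suppZeroFlag_two_iff (hU f) ((hU g).inter (hU a))).2 (Finset.disjoint_left.2 fun z hz1 hz2 => ?_)
      exact hcg z (htf z (mem_esupp.1 hz1)) (mem_esupp.1 hz2)
    have hz : ZVia (U f) (U g) (U a) := ⟨z1, z2, z3⟩
    -- place the triple inside the sub-family `U ∘ m.succAbove`
    obtain ⟨pf, hpf⟩ := Fin.exists_succAbove_eq (Ne.symm hmf)
    obtain ⟨pg, hpg⟩ := Fin.exists_succAbove_eq (Ne.symm hmg)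
    obtain ⟨pa, hpa⟩ := Fin.exists_succAbove_eq (Ne.symm hma)
    have hV : ZVia ((fun j => U (m.succAbove j)) pf) ((fun j => U (m.succAbove j)) pg) ((fun j => U (m.succAbove j)) pa) := by
      simp only [hpf, hpg, hpa]; exact hz
    refine hno m (suppZeroFlag_three_of_zVia_at (fun j => U (m.succAbove j)) pf pg pa ?_ ?_ ?_ hV)
    · rintro rfl; exact hfg (hpf.symm.trans hpg)
    · rintro rfl; exact haf (hpa.symm.trans hpf)
    · rintro rfl; exact hag (hpa.symm.trans hpg)


/-- **(EQI-4) on the all-r3 class, unconditionally**: for four non-empty increasing events with every coordinate ignored by exactly one of them,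
`E_4 ≡ 0` on the open cube iff the family is a zero flag (`Z_4`).  [If a sub-triple is in `Z_3` this is prim-master-conj's order-four step
`sahiE_four_ind_eq_zero_iff_of_zeroFlagTriple`; otherwise `E_4 ≢ 0` by (ALL-R3).] [this work] -/
theorem forall_sahiE_four_eq_zero_iff_suppZeroFlag_of_allR3 (U : Fin 4 → Set (Set ι)) (hU : ∀ j, IsUpperSet (U j)) (hne : ∀ j, (U j).Nonempty)
    (hr3 : ∀ e : ι, ∃ f : Fin 4, (∀ ω, insert e ω ∈ U f ↔ ω ∈ U f) ∧ ∀ j, j ≠ f → Affects (U j) e) :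
    (∀ p : ι → unitInterval, (∀ i, (p i : ℝ) ∈ Set.Ioo (0 : ℝ) 1) → sahiE (bernoulliWeight p) 4 (fun j => ind (U j)) = 0) ↔
      SuppZeroFlag 4 U := by
  refine ⟨fun hall => ?_, fun h p _ => sahiE_ind_eq_zero_of_suppZeroFlag p h⟩
  by_cases hsub : ∃ m : Fin 4, SuppZeroFlag 3 (fun j => U (m.succAbove j))
  · obtain ⟨m, hm⟩ := hsub
    exact (sahiE_four_ind_eq_zero_iff_of_zeroFlagTriple (halfParams ι) (halfParams_mem_Ioo ι) U hU m hm).1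
      (hall _ (halfParams_mem_Ioo ι))
  · push Not at hsub
    obtain ⟨p, hp, hpne⟩ := exists_interior_sahiE_four_ne_zero_of_allR3 U hU hne hr3 hsub
    exact absurd (hall p hp) hpne

end AllR3

end Summit.CriticalPhenomena.PercolationContinuityZ3.Theorems
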